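import Mathlib
import HarnessLib
import Summits.Ventures.LatticeQCDFlow.Exactness.U1KickDriftWords
import Summits.Ventures.LatticeQCDFlow.Exactness.U1WordDoeblin

/-!
# Multi-step HMC with ANY palindromic kick/drift word on `U(1)` lattice gauge fields is uniformly ergodic for short trajectories — OMF4 included

HONEST FRAMING: exact (Metropolis-corrected) sampling algorithms for lattice gauge theory;
figures of merit are autocorrelation/cost numbers at stated couplings and volumes; no
continuum-physics claim.

Venture `LatticeQCDFlow` (cell pub-lqcd), topic `Exactness`, FANOUT row 14 (`eng-flowhmc`, engine
`latflow.fthmc`, family B, `U(1)` rung, integrator menu `leapfrog` / `omf2` / `omf4` at any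
`n_md`).  NEW WORK of the cell over this row's `U1KickDriftWords.lean` (every kick/drift word is a
near-free-flight map with explicit constants), `U1NearFreeFlight.lean` (the power lemma),
`U1WordDoeblin.lean` (the integrator-independent Doeblin core) and row 9's `SplittingWords.lean`
(`omf4Word`, its stagewise flip reversibility and Liouville); nothing is cited as a fact; no number.
Printed counterparts, named only: Omelyan–Mryglod–Folk 2003; Mackenzie 1989.

* §1 **`u1KickDriftWord_pow_readings`** — for a word of `m` stages (kicks bounded by `b`,
  `L`-Lipschitz; drifts `|c| ≤ c₀`; `L c₀ m² ≤ 1/2`) with total drift `τ` and the two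
  short-trajectory conditions of the power lemma with the word's constants
  (`3(2Lm·τ²n² + 4Lc₀m²·|τ|n + 4Lc₀²m³) ≤ |τ|`, `2Lm|τ|n² + 4Lc₀m²n ≤ 1`): from every `u` the
  configuration proposed by `flip ∘ wordⁿ` is `e₁((nτ) • p + G_u p)·u`, `G_u` bounded and
  `(n|τ|/3)`-Lipschitz, and the proposed momentum has norm `≤ ‖p‖ + nbm`;
  **`u1KickDriftWordHMC_pow_uniformlyErgodic`** / **`_invariant_unique`** — if moreover `τ > 0`,
  `n ≥ 1`, `κ > 0`, `|S| ≤ s` measurable and `flip ∘ wordⁿ` is a measurable `Haar ⊗ Lebesgue`-preserving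
  involution (every palindromic word: `SplittingWords`), the HMC kernel converges to `π_S` from EVERY
  start and `π_S` is its unique invariant probability law.
* §2 THE OMF4 INSTANCE (eleven stages `K D_r K D_q K D_c K D_q K D_r K`, Omelyan–Mryglod–Folk; in
  the engine `θ < 0`, so the coefficients are signed — only `τ = 2r + 2q + c > 0` and `|·| ≤ c₀` are
  asked): `omf4Word_eq_stagesProd`, `measurable_/involutive_/measurePreserving_u1Omf4Proposal_pow`,
  **`u1Omf4HMC_pow_uniformlyErgodic`**, **`u1Omf4HMC_pow_invariant_unique`** under
  `121 L c₀ ≤ 1/2`, `3(22L τ²n² + 484Lc₀ τ n + 5324Lc₀²) ≤ τ`, `22Lτn² + 484Lc₀n ≤ 1`.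

NOT CLAIMED: optimal constants (the generic word bounds are crude: the leapfrog file has `Lεn² ≤ 1`,
the OMF2 file `64Lcn² ≤ 1`); `τ ≤ 0`; longer trajectories; `SU(2)`; floating point; any number.
-/

noncomputable section

namespace Summit.Ventures.LatticeQCDFlow.Exactness

open MeasureTheory ProbabilityTheory ProbabilityTheory.Kernel Set Metric
open Literature.MathematicalPhysics.QuantumFieldTheory (haarProbability)
open scoped ENNReal NNReal

variable {ι : Type*} [Fintype ι]

/-! ## §1 Any kick/drift word: readings, Doeblin, uniform ergodicity -/

section General

variable {κ b c₀ : ℝ} {L : ℝ≥0}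

/-- **Readings of the `n`-fold power of a kick/drift word** under the word's short-trajectory
conditions: the proposed configuration is one drift of `(nτ) • p + G_u p` with `G_u` bounded and
`(n|τ|/3)`-Lipschitz, the proposed momentum stays within `nbm` of `p`. -/
theorem u1KickDriftWord_pow_readings (hb : 0 ≤ b) (hc₀ : 0 ≤ c₀)
    (stages : List ((((ι → Circle) → ι → ℝ)) ⊕ ℝ))
    (hm : (L : ℝ) * c₀ * (stages.length : ℝ) ^ 2 ≤ 1 / 2)
    (hkick : ∀ g, Sum.inl g ∈ stages → (∀ v, ‖g v‖ ≤ b) ∧ LipschitzWith L g)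
    (hdrift : ∀ c, Sum.inr c ∈ stages → |c| ≤ c₀) {τ : ℝ}
    (hτ : (stages.map fun s => Sum.elim (fun _ => (0 : ℝ)) (fun c => c) s).sum = τ) {n : ℕ}
    (h1 : 3 * (2 * L * stages.length * |τ| ^ 2 * (n : ℝ) ^ 2 +
      (2 * L * c₀ * (stages.length : ℝ) ^ 2 + 2 * L * c₀ * (stages.length : ℝ) ^ 2) * |τ| * n +
      2 * (2 * L * c₀ ^ 2 * (stages.length : ℝ) ^ 3)) ≤ |τ|)
    (h2 : 2 * L * stages.length * |τ| * (n : ℝ) ^ 2 + 2 * (2 * L * c₀ * (stages.length : ℝ) ^ 2) * n ≤ 1) :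
    (∀ u, ∃ G : (ι → ℝ) → ι → ℝ,
      (∀ p, ‖G p‖ ≤ n * (c₀ * b * (stages.length : ℝ) ^ 2) + |τ| * (b * stages.length) * (n : ℝ) ^ 2 / 2) ∧
      LipschitzWith (Real.toNNReal (n * |τ| / 3)) G ∧
      ∀ p, (((flip : Equiv.Perm ((ι → Circle) × (ι → ℝ))) *
          (stages.map fun s => Sum.elim (fun g => kick g)
            (fun c => drift (mulDrift (u1ExpDrift (ι := ι) c))) s).prod ^ n) (u, p)).1 =
        u1ExpDrift 1 (((n : ℝ) * τ) • p + G p) * u) ∧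
    (∀ u p, ‖(((flip : Equiv.Perm ((ι → Circle) × (ι → ℝ))) *
        (stages.map fun s => Sum.elim (fun g => kick g)
          (fun c => drift (mulDrift (u1ExpDrift (ι := ι) c))) s).prod ^ n) (u, p)).2‖ ≤
      ‖p‖ + n * (b * stages.length)) := by
  obtain ⟨A, B, hΦ, hA0, hB0, hA, hB⟩ :=
    kickDriftWord_nearFreeFlight (ι := ι) hb hc₀ hm stages le_rfl hkick hdrift
  have hΦ' : ∀ z : (ι → Circle) × (ι → ℝ),
      (stages.map fun s => Sum.elim (fun g => kick g)
        (fun c => drift (mulDrift (u1ExpDrift (ι := ι) c))) s).prod z =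
      (u1ExpDrift 1 (τ • z.2 + A z.1 z.2) * z.1, z.2 + B z.1 z.2) := fun z => by rw [hΦ z, hτ]
  have hL0 : (0 : ℝ) ≤ L := NNReal.coe_nonneg L
  have hα₁ : 0 ≤ 2 * (L : ℝ) * c₀ * (stages.length : ℝ) ^ 2 := by positivity
  have hα₂ : 0 ≤ 2 * (L : ℝ) * c₀ ^ 2 * (stages.length : ℝ) ^ 3 := by positivity
  have hβ₁ : 0 ≤ 2 * (L : ℝ) * stages.length := by positivity
  refine ⟨fun u => ?_, fun u p => ?_⟩
  · obtain ⟨G, hGb, hGL, hfst⟩ :=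
      nearFreeFlight_iterate_fst hΦ' hA0 hB0 hA hB hα₁ hα₂ hβ₁ hα₁ h1 h2 u
    refine ⟨G, hGb, hGL, fun p => ?_⟩
    rw [Equiv.Perm.mul_apply, flip_apply, Equiv.Perm.coe_pow, hfst p]
  · rw [Equiv.Perm.mul_apply, flip_apply, Equiv.Perm.coe_pow]
    dsimp only
    rw [norm_neg]
    have h := nearFreeFlight_iterate_snd hΦ' hA0 hB0 hA hB hα₁ hα₂ hβ₁ hα₁ h1 h2 u p
    calc ‖((⇑(stages.map fun s => Sum.elim (fun g => kick g)
            (fun c => drift (mulDrift (u1ExpDrift (ι := ι) c))) s).prod)^[n] (u, p)).2‖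
        = ‖(((⇑(stages.map fun s => Sum.elim (fun g => kick g)
            (fun c => drift (mulDrift (u1ExpDrift (ι := ι) c))) s).prod)^[n] (u, p)).2 - p) + p‖ := by
          rw [sub_add_cancel]
      _ ≤ ‖((⇑(stages.map fun s => Sum.elim (fun g => kick g)
            (fun c => drift (mulDrift (u1ExpDrift (ι := ι) c))) s).prod)^[n] (u, p)).2 - p‖ + ‖p‖ :=
          norm_add_le _ _
      _ ≤ n * (b * stages.length) + ‖p‖ := add_le_add h le_rfl
      _ = ‖p‖ + n * (b * stages.length) := add_comm _ _

/-- **MULTI-STEP HMC WITH ANY PALINDROMIC KICK/DRIFT WORD ON `U(1)^ι` IS UNIFORMLY ERGODIC FOR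
SHORT TRAJECTORIES.**  Word as in `u1KickDriftWord_pow_readings` with `τ > 0`, `n ≥ 1`;
`flip ∘ wordⁿ` a measurable `Haar^{⊗ι} ⊗ Lebesgue`-preserving involution; `κ > 0`; measurable
`|S| ≤ s`: `|μ₀Kᵗ(A) − π_S(A)| ≤ (1 − δ)ᵗ` for some `δ ∈ (0, 1]`, EVERY initial law. -/
theorem u1KickDriftWordHMC_pow_uniformlyErgodic (hb : 0 ≤ b) (hc₀ : 0 ≤ c₀)
    (stages : List ((((ι → Circle) → ι → ℝ)) ⊕ ℝ))
    (hm : (L : ℝ) * c₀ * (stages.length : ℝ) ^ 2 ≤ 1 / 2)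
    (hkick : ∀ g, Sum.inl g ∈ stages → (∀ v, ‖g v‖ ≤ b) ∧ LipschitzWith L g)
    (hdrift : ∀ c, Sum.inr c ∈ stages → |c| ≤ c₀) {τ : ℝ}
    (hτ : (stages.map fun s => Sum.elim (fun _ => (0 : ℝ)) (fun c => c) s).sum = τ) (hτ0 : 0 < τ)
    {n : ℕ} (hn0 : 0 < n)
    (h1 : 3 * (2 * L * stages.length * |τ| ^ 2 * (n : ℝ) ^ 2 +
      (2 * L * c₀ * (stages.length : ℝ) ^ 2 + 2 * L * c₀ * (stages.length : ℝ) ^ 2) * |τ| * n +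
      2 * (2 * L * c₀ ^ 2 * (stages.length : ℝ) ^ 3)) ≤ |τ|)
    (h2 : 2 * L * stages.length * |τ| * (n : ℝ) ^ 2 + 2 * (2 * L * c₀ * (stages.length : ℝ) ^ 2) * n ≤ 1)
    (hΨ : Measurable (⇑((flip : Equiv.Perm ((ι → Circle) × (ι → ℝ))) *
      (stages.map fun s => Sum.elim (fun g => kick g)
        (fun c => drift (mulDrift (u1ExpDrift (ι := ι) c))) s).prod ^ n)))
    (hinv : Function.Involutive (⇑((flip : Equiv.Perm ((ι → Circle) × (ι → ℝ))) *
      (stages.map fun s => Sum.elim (fun g => kick g)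
        (fun c => drift (mulDrift (u1ExpDrift (ι := ι) c))) s).prod ^ n)))
    (hmp : MeasurePreserving (⇑((flip : Equiv.Perm ((ι → Circle) × (ι → ℝ))) *
      (stages.map fun s => Sum.elim (fun g => kick g)
        (fun c => drift (mulDrift (u1ExpDrift (ι := ι) c))) s).prod ^ n))
      ((Measure.pi fun _ : ι => haarProbability Circle).prod volume)
      ((Measure.pi fun _ : ι => haarProbability Circle).prod volume))
    (hκ : 0 < κ) {S : (ι → Circle) → ℝ} (hS : Measurable S) {s : ℝ} (hs : ∀ u, |S u| ≤ s) :
    ∃ δ : ℝ, 0 < δ ∧ δ ≤ 1 ∧ ∀ (μ₀ : Measure (ι → Circle)) [IsProbabilityMeasure μ₀] (t : ℕ)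
      (A : Set (ι → Circle)),
      |((fun m : Measure (ι → Circle) => m.bind
          (refreshUpdate (involMH _ hΨ fun z : (ι → Circle) × (ι → ℝ) => S z.1 + u1Kinetic κ z.2)
            (u1MomentumLaw κ)))^[t] μ₀).real A - (u1GibbsLaw S).real A| ≤ (1 - δ) ^ t := by
  obtain ⟨hfst, hsnd⟩ := u1KickDriftWord_pow_readings (ι := ι) hb hc₀ stages hm hkick hdrift hτ h1 h2
  have hnR : (0 : ℝ) < n := by exact_mod_cast hn0
  have ha : (0 : ℝ) < n * τ := by positivity
  have hlam : ((Real.toNNReal (n * |τ| / 3) : ℝ≥0) : ℝ) < n * τ := by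
    rw [Real.coe_toNNReal _ (by positivity), abs_of_pos hτ0]
    nlinarith
  exact u1Word_uniformlyErgodic hΨ hκ ha hlam (by positivity) hfst hsnd hS hs
    (u1Word_invariant_gibbsLaw hΨ hκ hinv hmp hS)

/-- **`π_S` is the unique invariant probability law** (same hypotheses). -/
theorem u1KickDriftWordHMC_pow_invariant_unique (hb : 0 ≤ b) (hc₀ : 0 ≤ c₀)
    (stages : List ((((ι → Circle) → ι → ℝ)) ⊕ ℝ))
    (hm : (L : ℝ) * c₀ * (stages.length : ℝ) ^ 2 ≤ 1 / 2)
    (hkick : ∀ g, Sum.inl g ∈ stages → (∀ v, ‖g v‖ ≤ b) ∧ LipschitzWith L g)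
    (hdrift : ∀ c, Sum.inr c ∈ stages → |c| ≤ c₀) {τ : ℝ}
    (hτ : (stages.map fun s => Sum.elim (fun _ => (0 : ℝ)) (fun c => c) s).sum = τ) (hτ0 : 0 < τ)
    {n : ℕ} (hn0 : 0 < n)
    (h1 : 3 * (2 * L * stages.length * |τ| ^ 2 * (n : ℝ) ^ 2 +
      (2 * L * c₀ * (stages.length : ℝ) ^ 2 + 2 * L * c₀ * (stages.length : ℝ) ^ 2) * |τ| * n +
      2 * (2 * L * c₀ ^ 2 * (stages.length : ℝ) ^ 3)) ≤ |τ|)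
    (h2 : 2 * L * stages.length * |τ| * (n : ℝ) ^ 2 + 2 * (2 * L * c₀ * (stages.length : ℝ) ^ 2) * n ≤ 1)
    (hΨ : Measurable (⇑((flip : Equiv.Perm ((ι → Circle) × (ι → ℝ))) *
      (stages.map fun s => Sum.elim (fun g => kick g)
        (fun c => drift (mulDrift (u1ExpDrift (ι := ι) c))) s).prod ^ n)))
    (hinv : Function.Involutive (⇑((flip : Equiv.Perm ((ι → Circle) × (ι → ℝ))) *
      (stages.map fun s => Sum.elim (fun g => kick g)
        (fun c => drift (mulDrift (u1ExpDrift (ι := ι) c))) s).prod ^ n)))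
    (hmp : MeasurePreserving (⇑((flip : Equiv.Perm ((ι → Circle) × (ι → ℝ))) *
      (stages.map fun s => Sum.elim (fun g => kick g)
        (fun c => drift (mulDrift (u1ExpDrift (ι := ι) c))) s).prod ^ n))
      ((Measure.pi fun _ : ι => haarProbability Circle).prod volume)
      ((Measure.pi fun _ : ι => haarProbability Circle).prod volume))
    (hκ : 0 < κ) {S : (ι → Circle) → ℝ} (hS : Measurable S) {s : ℝ} (hs : ∀ u, |S u| ≤ s)
    {π' : Measure (ι → Circle)} [IsProbabilityMeasure π']
    (hπ' : Invariant (refreshUpdate (involMH _ hΨ fun z : (ι → Circle) × (ι → ℝ) =>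
      S z.1 + u1Kinetic κ z.2) (u1MomentumLaw κ)) π') :
    π' = u1GibbsLaw S := by
  obtain ⟨hfst, hsnd⟩ := u1KickDriftWord_pow_readings (ι := ι) hb hc₀ stages hm hkick hdrift hτ h1 h2
  have hnR : (0 : ℝ) < n := by exact_mod_cast hn0
  have ha : (0 : ℝ) < n * τ := by positivity
  have hlam : ((Real.toNNReal (n * |τ| / 3) : ℝ≥0) : ℝ) < n * τ := by
    rw [Real.coe_toNNReal _ (by positivity), abs_of_pos hτ0]
    nlinarith
  exact u1Word_invariant_unique hΨ hκ ha hlam (by positivity) hfst hsnd hS hs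
    (u1Word_invariant_gibbsLaw hΨ hκ hinv hmp hS) hπ'

end General

/-! ## §2 The OMF4 instance (eleven stages) -/

section Omf4

variable (r q c : ℝ) (gᵥ gₗ g_c : (ι → Circle) → ι → ℝ)

omit [Fintype ι] in
/-- The OMF4 word is the eleven-stage kick/drift word `K(gᵥ) D_r K(gₗ) D_q K(g_c) D_c K(g_c) D_q
K(gₗ) D_r K(gᵥ)`. -/
theorem omf4Word_eq_stagesProd :
    omf4Word gᵥ (mulDrift (u1ExpDrift r)) gₗ (mulDrift (u1ExpDrift q)) g_c (mulDrift (u1ExpDrift c)) =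
      (([Sum.inl gᵥ, Sum.inr r, Sum.inl gₗ, Sum.inr q, Sum.inl g_c, Sum.inr c, Sum.inl g_c, Sum.inr q,
          Sum.inl gₗ, Sum.inr r, Sum.inl gᵥ] : List ((((ι → Circle) → ι → ℝ)) ⊕ ℝ)).map
        fun s => Sum.elim (fun g => kick g) (fun c => drift (mulDrift (u1ExpDrift (ι := ι) c))) s).prod :=
  Equiv.ext fun _ => rfl

/-- `flip ∘ (OMF4)ⁿ` is measurable (measurable kicks). -/
theorem measurable_u1Omf4Proposal_pow (hgᵥ : Measurable gᵥ) (hgₗ : Measurable gₗ)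
    (hg_c : Measurable g_c) (n : ℕ) :
    Measurable (⇑((flip : Equiv.Perm ((ι → Circle) × (ι → ℝ))) *
      omf4Word gᵥ (mulDrift (u1ExpDrift r)) gₗ (mulDrift (u1ExpDrift q)) g_c
        (mulDrift (u1ExpDrift c)) ^ n)) := by
  haveI := isNegInvariant_volume_pi (Λ := ι)
  exact measurable_flip_palindromicWord_pow
    (vol := (Measure.pi fun _ : ι => haarProbability Circle).prod volume) measurePreserving_flip
    (measurePreserving_drift (measurable_mulDrift (measurable_u1ExpDrift c))
      (measurePreserving_mulDrift (u1ExpDrift c)))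
    (omf4_stages_measurePreserving (measurable_mulDrift (measurable_u1ExpDrift r))
      (measurePreserving_mulDrift (u1ExpDrift r)) (measurable_mulDrift (measurable_u1ExpDrift q))
      (measurePreserving_mulDrift (u1ExpDrift q)) hgᵥ hgₗ hg_c) n

omit [Fintype ι] in
/-- `flip ∘ (OMF4)ⁿ` is an involution. -/
theorem involutive_u1Omf4Proposal_pow (n : ℕ) :
    Function.Involutive (⇑((flip : Equiv.Perm ((ι → Circle) × (ι → ℝ))) *
      omf4Word gᵥ (mulDrift (u1ExpDrift r)) gₗ (mulDrift (u1ExpDrift q)) g_c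
        (mulDrift (u1ExpDrift c)) ^ n)) :=
  (palindromicWord_pow_isFlipReversible flip_mul_flip
    (drift_isFlipReversible (mulDrift_reversal (u1ExpDrift_neg c)))
    (omf4_stages_isFlipReversible (mulDrift_reversal (u1ExpDrift_neg r))
      (mulDrift_reversal (u1ExpDrift_neg q))) n).involutive

/-- `flip ∘ (OMF4)ⁿ` preserves `Haar^{⊗ι} ⊗ Lebesgue`. -/
theorem measurePreserving_u1Omf4Proposal_pow (hgᵥ : Measurable gᵥ) (hgₗ : Measurable gₗ)
    (hg_c : Measurable g_c) (n : ℕ) :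
    MeasurePreserving (⇑((flip : Equiv.Perm ((ι → Circle) × (ι → ℝ))) *
        omf4Word gᵥ (mulDrift (u1ExpDrift r)) gₗ (mulDrift (u1ExpDrift q)) g_c
          (mulDrift (u1ExpDrift c)) ^ n))
      ((Measure.pi fun _ : ι => haarProbability Circle).prod volume)
      ((Measure.pi fun _ : ι => haarProbability Circle).prod volume) := by
  haveI := isNegInvariant_volume_pi (Λ := ι)
  rw [Equiv.Perm.coe_mul]
  exact measurePreserving_flip.comp (measurePreserving_perm_pow
    (measurePreserving_palindromicWord
      (measurePreserving_drift (measurable_mulDrift (measurable_u1ExpDrift c))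
        (measurePreserving_mulDrift (u1ExpDrift c)))
      (omf4_stages_measurePreserving (measurable_mulDrift (measurable_u1ExpDrift r))
        (measurePreserving_mulDrift (u1ExpDrift r)) (measurable_mulDrift (measurable_u1ExpDrift q))
        (measurePreserving_mulDrift (u1ExpDrift q)) hgᵥ hgₗ hg_c)) n)

variable {r q c gᵥ gₗ g_c} {κ b c₀ : ℝ} {L : ℝ≥0} {S : (ι → Circle) → ℝ} {s : ℝ}

/-- The OMF4 readings: under the short-trajectory conditions the configuration proposed by
`flip ∘ (OMF4)ⁿ` is one drift of `(nτ) • p + G_u p` (`τ = 2r + 2q + c`), `G_u` bounded and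
`(n|τ|/3)`-Lipschitz, and the proposed momentum has norm `≤ ‖p‖ + 11nb`. -/
theorem u1Omf4_pow_readings (hb : 0 ≤ b) (hc₀ : 0 ≤ c₀)
    (hbᵥ : ∀ v, ‖gᵥ v‖ ≤ b) (hbₗ : ∀ v, ‖gₗ v‖ ≤ b) (hb_c : ∀ v, ‖g_c v‖ ≤ b)
    (hLᵥ : LipschitzWith L gᵥ) (hLₗ : LipschitzWith L gₗ) (hL_c : LipschitzWith L g_c)
    (hr : |r| ≤ c₀) (hq : |q| ≤ c₀) (hc : |c| ≤ c₀) (hτ0 : 0 < 2 * r + 2 * q + c)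
    (hm : 121 * (L : ℝ) * c₀ ≤ 1 / 2) {n : ℕ}
    (h1 : 3 * (22 * L * (2 * r + 2 * q + c) ^ 2 * (n : ℝ) ^ 2 + 484 * L * c₀ * (2 * r + 2 * q + c) * n +
      5324 * L * c₀ ^ 2) ≤ 2 * r + 2 * q + c)
    (h2 : 22 * L * (2 * r + 2 * q + c) * (n : ℝ) ^ 2 + 484 * L * c₀ * n ≤ 1) :
    (∀ u, ∃ G : (ι → ℝ) → ι → ℝ,
      (∀ p, ‖G p‖ ≤ n * (c₀ * b * (11 : ℝ) ^ 2) + |2 * r + 2 * q + c| * (b * 11) * (n : ℝ) ^ 2 / 2) ∧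
      LipschitzWith (Real.toNNReal (n * |2 * r + 2 * q + c| / 3)) G ∧
      ∀ p, (((flip : Equiv.Perm ((ι → Circle) × (ι → ℝ))) *
          omf4Word gᵥ (mulDrift (u1ExpDrift r)) gₗ (mulDrift (u1ExpDrift q)) g_c
            (mulDrift (u1ExpDrift c)) ^ n) (u, p)).1 =
        u1ExpDrift 1 (((n : ℝ) * (2 * r + 2 * q + c)) • p + G p) * u) ∧
    (∀ u p, ‖(((flip : Equiv.Perm ((ι → Circle) × (ι → ℝ))) *
        omf4Word gᵥ (mulDrift (u1ExpDrift r)) gₗ (mulDrift (u1ExpDrift q)) g_c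
          (mulDrift (u1ExpDrift c)) ^ n) (u, p)).2‖ ≤ ‖p‖ + n * (b * 11)) := by
  have hlen : (([Sum.inl gᵥ, Sum.inr r, Sum.inl gₗ, Sum.inr q, Sum.inl g_c, Sum.inr c, Sum.inl g_c,
      Sum.inr q, Sum.inl gₗ, Sum.inr r, Sum.inl gᵥ] : List ((((ι → Circle) → ι → ℝ)) ⊕ ℝ)).length : ℝ) =
      11 := by simp
  have hτabs : |2 * r + 2 * q + c| = 2 * r + 2 * q + c := abs_of_pos hτ0
  have hL0 : (0 : ℝ) ≤ L := NNReal.coe_nonneg L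
  have hkick : ∀ g, Sum.inl g ∈ ([Sum.inl gᵥ, Sum.inr r, Sum.inl gₗ, Sum.inr q, Sum.inl g_c, Sum.inr c,
      Sum.inl g_c, Sum.inr q, Sum.inl gₗ, Sum.inr r, Sum.inl gᵥ] : List ((((ι → Circle) → ι → ℝ)) ⊕ ℝ)) →
      (∀ v, ‖g v‖ ≤ b) ∧ LipschitzWith L g := by
    intro g hg
    simp only [List.mem_cons, Sum.inl.injEq, reduceCtorEq, List.not_mem_nil, or_false, false_or] at hg
    rcases hg with rfl | rfl | rfl | rfl | rfl | rfl
    · exact ⟨hbᵥ, hLᵥ⟩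
    · exact ⟨hbₗ, hLₗ⟩
    · exact ⟨hb_c, hL_c⟩
    · exact ⟨hb_c, hL_c⟩
    · exact ⟨hbₗ, hLₗ⟩
    · exact ⟨hbᵥ, hLᵥ⟩
  have hdrift : ∀ c', Sum.inr c' ∈ ([Sum.inl gᵥ, Sum.inr r, Sum.inl gₗ, Sum.inr q, Sum.inl g_c, Sum.inr c,
      Sum.inl g_c, Sum.inr q, Sum.inl gₗ, Sum.inr r, Sum.inl gᵥ] : List ((((ι → Circle) → ι → ℝ)) ⊕ ℝ)) →
      |c'| ≤ c₀ := by
    intro c' hc'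
    simp only [List.mem_cons, Sum.inr.injEq, reduceCtorEq, List.not_mem_nil, or_false, false_or] at hc'
    rcases hc' with rfl | rfl | rfl | rfl | rfl
    · exact hr
    · exact hq
    · exact hc
    · exact hq
    · exact hr
  have hm' : (L : ℝ) * c₀ * ((([Sum.inl gᵥ, Sum.inr r, Sum.inl gₗ, Sum.inr q, Sum.inl g_c, Sum.inr c,
      Sum.inl g_c, Sum.inr q, Sum.inl gₗ, Sum.inr r, Sum.inl gᵥ] :
        List ((((ι → Circle) → ι → ℝ)) ⊕ ℝ)).length : ℕ) : ℝ) ^ 2 ≤ 1 / 2 := by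
    rw [hlen]; nlinarith
  have hsum : (([Sum.inl gᵥ, Sum.inr r, Sum.inl gₗ, Sum.inr q, Sum.inl g_c, Sum.inr c, Sum.inl g_c,
      Sum.inr q, Sum.inl gₗ, Sum.inr r, Sum.inl gᵥ] : List ((((ι → Circle) → ι → ℝ)) ⊕ ℝ)).map
        fun s => Sum.elim (fun _ => (0 : ℝ)) (fun c => c) s).sum = 2 * r + 2 * q + c := by
    simp only [List.map_cons, List.map_nil, List.sum_cons, List.sum_nil, Sum.elim_inl, Sum.elim_inr]
    ring
  have h1' : 3 * (2 * (L : ℝ) * ((([Sum.inl gᵥ, Sum.inr r, Sum.inl gₗ, Sum.inr q, Sum.inl g_c, Sum.inr c,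
      Sum.inl g_c, Sum.inr q, Sum.inl gₗ, Sum.inr r, Sum.inl gᵥ] :
        List ((((ι → Circle) → ι → ℝ)) ⊕ ℝ)).length : ℕ) : ℝ) * |2 * r + 2 * q + c| ^ 2 * (n : ℝ) ^ 2 +
      (2 * L * c₀ * ((([Sum.inl gᵥ, Sum.inr r, Sum.inl gₗ, Sum.inr q, Sum.inl g_c, Sum.inr c,
        Sum.inl g_c, Sum.inr q, Sum.inl gₗ, Sum.inr r, Sum.inl gᵥ] :
          List ((((ι → Circle) → ι → ℝ)) ⊕ ℝ)).length : ℕ) : ℝ) ^ 2 +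
        2 * L * c₀ * ((([Sum.inl gᵥ, Sum.inr r, Sum.inl gₗ, Sum.inr q, Sum.inl g_c, Sum.inr c,
        Sum.inl g_c, Sum.inr q, Sum.inl gₗ, Sum.inr r, Sum.inl gᵥ] :
          List ((((ι → Circle) → ι → ℝ)) ⊕ ℝ)).length : ℕ) : ℝ) ^ 2) * |2 * r + 2 * q + c| * n +
      2 * (2 * L * c₀ ^ 2 * ((([Sum.inl gᵥ, Sum.inr r, Sum.inl gₗ, Sum.inr q, Sum.inl g_c, Sum.inr c,
        Sum.inl g_c, Sum.inr q, Sum.inl gₗ, Sum.inr r, Sum.inl gᵥ] :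
          List ((((ι → Circle) → ι → ℝ)) ⊕ ℝ)).length : ℕ) : ℝ) ^ 3)) ≤ |2 * r + 2 * q + c| := by
    rw [hlen, hτabs]; nlinarith
  have h2' : 2 * (L : ℝ) * ((([Sum.inl gᵥ, Sum.inr r, Sum.inl gₗ, Sum.inr q, Sum.inl g_c, Sum.inr c,
      Sum.inl g_c, Sum.inr q, Sum.inl gₗ, Sum.inr r, Sum.inl gᵥ] :
        List ((((ι → Circle) → ι → ℝ)) ⊕ ℝ)).length : ℕ) : ℝ) * |2 * r + 2 * q + c| * (n : ℝ) ^ 2 +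
      2 * (2 * L * c₀ * ((([Sum.inl gᵥ, Sum.inr r, Sum.inl gₗ, Sum.inr q, Sum.inl g_c, Sum.inr c,
        Sum.inl g_c, Sum.inr q, Sum.inl gₗ, Sum.inr r, Sum.inl gᵥ] :
          List ((((ι → Circle) → ι → ℝ)) ⊕ ℝ)).length : ℕ) : ℝ) ^ 2) * n ≤ 1 := by
    rw [hlen, hτabs]; nlinarith
  obtain ⟨hfst, hsnd⟩ := u1KickDriftWord_pow_readings (ι := ι) hb hc₀ _ hm' hkick hdrift hsum h1' h2'
  rw [hlen, ← omf4Word_eq_stagesProd] at hfst hsnd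
  exact ⟨hfst, hsnd⟩

/-- **`n`-STEP OMF4 HMC ON `U(1)^ι` IS UNIFORMLY ERGODIC FOR SHORT TRAJECTORIES.**  Kicks
`gᵥ, gₗ, g_c` bounded by `b`, `L`-Lipschitz; drift coefficients `|r|, |q|, |c| ≤ c₀` with total
`τ = 2r + 2q + c > 0`; `121 L c₀ ≤ 1/2`; `3(22Lτ²n² + 484Lc₀τn + 5324Lc₀²) ≤ τ` and
`22Lτn² + 484Lc₀n ≤ 1`; `n ≥ 1`, `κ > 0`, measurable `|S| ≤ s`. -/
theorem u1Omf4HMC_pow_uniformlyErgodic (hb : 0 ≤ b) (hc₀ : 0 ≤ c₀)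
    (hbᵥ : ∀ v, ‖gᵥ v‖ ≤ b) (hbₗ : ∀ v, ‖gₗ v‖ ≤ b) (hb_c : ∀ v, ‖g_c v‖ ≤ b)
    (hLᵥ : LipschitzWith L gᵥ) (hLₗ : LipschitzWith L gₗ) (hL_c : LipschitzWith L g_c)
    (hr : |r| ≤ c₀) (hq : |q| ≤ c₀) (hc : |c| ≤ c₀) (hτ0 : 0 < 2 * r + 2 * q + c)
    (hm : 121 * (L : ℝ) * c₀ ≤ 1 / 2) {n : ℕ} (hn0 : 0 < n)
    (h1 : 3 * (22 * L * (2 * r + 2 * q + c) ^ 2 * (n : ℝ) ^ 2 + 484 * L * c₀ * (2 * r + 2 * q + c) * n +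
      5324 * L * c₀ ^ 2) ≤ 2 * r + 2 * q + c)
    (h2 : 22 * L * (2 * r + 2 * q + c) * (n : ℝ) ^ 2 + 484 * L * c₀ * n ≤ 1)
    (hgᵥ : Measurable gᵥ) (hgₗ : Measurable gₗ) (hg_c : Measurable g_c)
    (hκ : 0 < κ) (hS : Measurable S) (hs : ∀ u, |S u| ≤ s) :
    ∃ δ : ℝ, 0 < δ ∧ δ ≤ 1 ∧ ∀ (μ₀ : Measure (ι → Circle)) [IsProbabilityMeasure μ₀] (t : ℕ)
      (A : Set (ι → Circle)),
      |((fun m : Measure (ι → Circle) => m.bind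
          (refreshUpdate (involMH _ (measurable_u1Omf4Proposal_pow r q c gᵥ gₗ g_c hgᵥ hgₗ hg_c n)
            fun z : (ι → Circle) × (ι → ℝ) => S z.1 + u1Kinetic κ z.2) (u1MomentumLaw κ)))^[t] μ₀).real A
          - (u1GibbsLaw S).real A| ≤ (1 - δ) ^ t := by
  obtain ⟨hfst, hsnd⟩ := u1Omf4_pow_readings (ι := ι) hb hc₀ hbᵥ hbₗ hb_c hLᵥ hLₗ hL_c hr hq hc hτ0
    hm (n := n) h1 h2
  have hnR : (0 : ℝ) < n := by exact_mod_cast hn0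
  have ha : (0 : ℝ) < n * (2 * r + 2 * q + c) := by positivity
  have hlam : ((Real.toNNReal (n * |2 * r + 2 * q + c| / 3) : ℝ≥0) : ℝ) < n * (2 * r + 2 * q + c) := by
    rw [Real.coe_toNNReal _ (by positivity), abs_of_pos hτ0]
    nlinarith
  exact u1Word_uniformlyErgodic _ hκ ha hlam (by positivity) hfst hsnd hS hs
    (u1Word_invariant_gibbsLaw _ hκ (involutive_u1Omf4Proposal_pow r q c gᵥ gₗ g_c n)
      (measurePreserving_u1Omf4Proposal_pow r q c gᵥ gₗ g_c hgᵥ hgₗ hg_c n) hS)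

/-- **`π_S` is the unique invariant probability law of `n`-step OMF4 HMC on `U(1)^ι`** (same
hypotheses). -/
theorem u1Omf4HMC_pow_invariant_unique (hb : 0 ≤ b) (hc₀ : 0 ≤ c₀)
    (hbᵥ : ∀ v, ‖gᵥ v‖ ≤ b) (hbₗ : ∀ v, ‖gₗ v‖ ≤ b) (hb_c : ∀ v, ‖g_c v‖ ≤ b)
    (hLᵥ : LipschitzWith L gᵥ) (hLₗ : LipschitzWith L gₗ) (hL_c : LipschitzWith L g_c)
    (hr : |r| ≤ c₀) (hq : |q| ≤ c₀) (hc : |c| ≤ c₀) (hτ0 : 0 < 2 * r + 2 * q + c)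
    (hm : 121 * (L : ℝ) * c₀ ≤ 1 / 2) {n : ℕ} (hn0 : 0 < n)
    (h1 : 3 * (22 * L * (2 * r + 2 * q + c) ^ 2 * (n : ℝ) ^ 2 + 484 * L * c₀ * (2 * r + 2 * q + c) * n +
      5324 * L * c₀ ^ 2) ≤ 2 * r + 2 * q + c)
    (h2 : 22 * L * (2 * r + 2 * q + c) * (n : ℝ) ^ 2 + 484 * L * c₀ * n ≤ 1)
    (hgᵥ : Measurable gᵥ) (hgₗ : Measurable gₗ) (hg_c : Measurable g_c)
    (hκ : 0 < κ) (hS : Measurable S) (hs : ∀ u, |S u| ≤ s)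
    {π' : Measure (ι → Circle)} [IsProbabilityMeasure π']
    (hπ' : Invariant (refreshUpdate (involMH _
        (measurable_u1Omf4Proposal_pow r q c gᵥ gₗ g_c hgᵥ hgₗ hg_c n)
        fun z : (ι → Circle) × (ι → ℝ) => S z.1 + u1Kinetic κ z.2) (u1MomentumLaw κ)) π') :
    π' = u1GibbsLaw S := by
  obtain ⟨hfst, hsnd⟩ := u1Omf4_pow_readings (ι := ι) hb hc₀ hbᵥ hbₗ hb_c hLᵥ hLₗ hL_c hr hq hc hτ0
    hm (n := n) h1 h2
  have hnR : (0 : ℝ) < n := by exact_mod_cast hn0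
  have ha : (0 : ℝ) < n * (2 * r + 2 * q + c) := by positivity
  have hlam : ((Real.toNNReal (n * |2 * r + 2 * q + c| / 3) : ℝ≥0) : ℝ) < n * (2 * r + 2 * q + c) := by
    rw [Real.coe_toNNReal _ (by positivity), abs_of_pos hτ0]
    nlinarith
  exact u1Word_invariant_unique _ hκ ha hlam (by positivity) hfst hsnd hS hs
    (u1Word_invariant_gibbsLaw _ hκ (involutive_u1Omf4Proposal_pow r q c gᵥ gₗ g_c n)
      (measurePreserving_u1Omf4Proposal_pow r q c gᵥ gₗ g_c hgᵥ hgₗ hg_c n) hS) hπ'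

end Omf4

end Summit.Ventures.LatticeQCDFlow.Exactness
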